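import Mathlib
import Literature.Analysis.FluidPDE.PressureEquationSlicing
import HarnessLib

/-!
# The pressure × velocity bound on a ball, one time slice, by the local pressure splitting
# (crux `EulerZoomLiouville.PowerGaugeEulerLiouville` = stmt-NavierStokesRegularity-19832, lead's line `birth`)

Route `EulerZoomLiouville` (NavierStokesRegularity).  The window-flux strata of the open core (`…WindowFlux`,
`…EnergyVanishing`, `…EnergyMonotone`, `…EnergyEscape`) stop at `ρ > 2/5` only because the pressure flux
`∫∫ |p||u|` was bounded by Hölder with the `D`-gauge (`(c a^{2−2ρ})^{2/3} (∫∫|u|³)^{1/3}`,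
`…WindowFluxBounds.lintegral_pressure_velocity_window_le`).  This file is the first brick of the sharper route
through the LOCAL PRESSURE SPLITTING `p = p₁ + p₂` on a ball (`p₁` = the whole-space pressure of `χ_{B_r}u`,
`‖p₁‖_{3/2} ≤ C ‖u‖²_{3,B_r}` by the tree's PROVED Calderón–Zygmund bound
`stein1970_normalisedPressure_Lp_bound_holds` via `exists_wholeSpacePressure_three`; `p₂` weakly harmonic in
`B_r` with the interior bound `exists_const_ae_abs_le_integral_of_weaklyHarmonic`), at ONE TIME SLICE:

* `exists_setLIntegral_pressure_velocity_ball_le` — an absolute `c` such that for `p ∈ L^{3/2}(B_r)`,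
  `u ∈ L³(B_r)` with the slice pressure equation `∫ p Δψ = −∫ D²ψ(u,u)` (`ψ ∈ C_c^∞(B_r)`):
  `∫_{B_{r/2}} |p||u| ≤ c · [ ∫_{B_r}|u|³ + r⁻³ (∫_{B_{r/2}}|u|) (∫_{B_r}|p| + r (∫_{B_r}|u|³)^{2/3}) ]`.
  The first term is the CUBIC rate (the pairing `|p₁||u|` costs no more than `|u|³`); the second is the harmonic
  remainder, paid in `L¹` norms only.  Integrated over a time window against the gauges this gives
  `∫∫_{(α,β)×B_a}|p||u| ≲ a^{3/2−9ρ/4} + a^{4/3−7ρ/3} + a^{1−5ρ/2}` in place of `a^{11/6−25ρ/12}`, i.e. window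
  flux integrability — and with it «from rest», «energy-quiescent past», «tight past», the global energy
  inequality — for `ρ > 2/9` instead of `ρ > 2/5` (successor files).

Proof: verbatim the splitting of `PressureSliceDecay.setLIntegral_pressure_ball_le_of_stein` (Seregin 2005,
(p9)–(p12)), with Hölder `∫|p₁||u| ≤ ‖p₁‖_{3/2}‖χu‖₃` and `∫_{B_{r/2}}|p₂||u| ≤ (sup_{B_{r/2}}|p₂|) ∫_{B_{r/2}}|u|`
in place of the `L^{3/2}` bookkeeping.  WHAT THIS IS NOT: not NS, not the open core; a helper `--supports`
stmt-19832. [folklore]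
-/

noncomputable section

set_option linter.dupNamespace false

open MeasureTheory Set Filter Topology Metric Function TopologicalSpace
open scoped ENNReal NNReal ContDiff Laplacian

namespace Summit.NavierStokesRegularity.NavierStokesRegularity.Theorems.PowerGaugeEulerLiouville

open Literature.Analysis Literature.Analysis.FunctionSpaces Literature.Analysis.FluidPDE

-- nested operator types (curried second derivatives)
set_option maxSynthPendingDepth 3 in
/-- **Pressure × velocity on a half ball, one time slice.**  There is an absolute constant `c` such that: if
`p ∈ L^{3/2}(B_r(x₀))` and `u ∈ L³(B_r(x₀))` satisfy `∫ p Δψ = -∫ D²ψ(u, u)` for every test function `ψ`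
supported in `B_r(x₀)`, then
`∫_{B_{r/2}} |p||u| ≤ c (∫_{B_r}|u|³ + (r³)⁻¹ (∫_{B_{r/2}}|u|) (∫_{B_r}|p| + r (∫_{B_r}|u|³)^{2/3}))`
(splitting `p = p₁ + p₂`, `p₁` the whole-space pressure of `χ_{B_r}u` — `exists_wholeSpacePressure_three`,
Stein's bound proved in the tree —, `p₂` weakly harmonic in `B_r` with
`sup_{B_{r/2}}|p₂| ≤ C r⁻³ ∫_{B_r}|p₂|`). [folklore] -/
theorem exists_setLIntegral_pressure_velocity_ball_le :
    ∃ c : ℝ≥0, ∀ (x₀ : EuclideanSpace ℝ (Fin 3)) (r : ℝ) (p : EuclideanSpace ℝ (Fin 3) → ℝ)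
      (u : EuclideanSpace ℝ (Fin 3) → EuclideanSpace ℝ (Fin 3)), 0 < r →
      AEStronglyMeasurable p (volume.restrict (ball x₀ r)) →
      AEStronglyMeasurable u (volume.restrict (ball x₀ r)) →
      ∫⁻ x in ball x₀ r, ‖p x‖ₑ ^ (3 / 2 : ℝ) < ⊤ →
      ∫⁻ x in ball x₀ r, ‖u x‖ₑ ^ (3 : ℕ) < ⊤ →
      (∀ ψ : EuclideanSpace ℝ (Fin 3) → ℝ, ContDiff ℝ (⊤ : ℕ∞) ψ → HasCompactSupport ψ →
        tsupport ψ ⊆ ball x₀ r →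
        ∫ x, p x * (Δ ψ) x = -∫ x, fderiv ℝ (fderiv ℝ ψ) x (u x) (u x)) →
      ∫⁻ x in ball x₀ (r / 2), ‖p x‖ₑ * ‖u x‖ₑ ≤
        c * ((∫⁻ x in ball x₀ r, ‖u x‖ₑ ^ (3 : ℕ)) +
          ENNReal.ofReal ((r ^ 3)⁻¹) * (∫⁻ x in ball x₀ (r / 2), ‖u x‖ₑ) *
            ((∫⁻ x in ball x₀ r, ‖p x‖ₑ) +
              ENNReal.ofReal r * (∫⁻ x in ball x₀ r, ‖u x‖ₑ ^ (3 : ℕ)) ^ (2 / 3 : ℝ))) := by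
  obtain ⟨C, hC⟩ := exists_wholeSpacePressure_three
  obtain ⟨C₃, hC₃0, hB3⟩ := exists_const_ae_abs_le_integral_of_weaklyHarmonic
  -- the constants
  set V₁ : ℝ≥0∞ := volume (ball (0 : EuclideanSpace ℝ (Fin 3)) 1) with hV₁
  have hV₁t : V₁ ≠ ⊤ := measure_ball_lt_top.ne
  set A : ℝ≥0∞ := (C : ℝ≥0∞) ^ (3 / 2 : ℝ) with hA
  have hAt : A ≠ ⊤ := ENNReal.rpow_ne_top_of_nonneg (by norm_num) ENNReal.coe_ne_top
  set A' : ℝ≥0∞ := A ^ (2 / 3 : ℝ) with hA'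
  have hA't : A' ≠ ⊤ := ENNReal.rpow_ne_top_of_nonneg (by norm_num) hAt
  set W : ℝ≥0∞ := V₁ ^ (1 / 3 : ℝ) with hW
  have hWt : W ≠ ⊤ := ENNReal.rpow_ne_top_of_nonneg (by norm_num) hV₁t
  set c : ℝ≥0∞ := (A' + 1) * (ENNReal.ofReal C₃ + 1) * (W + 1) with hc
  have hct : c ≠ ⊤ :=
    ENNReal.mul_ne_top (ENNReal.mul_ne_top (ENNReal.add_ne_top.2 ⟨hA't, ENNReal.one_ne_top⟩)
      (ENNReal.add_ne_top.2 ⟨ENNReal.ofReal_ne_top, ENNReal.one_ne_top⟩))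
      (ENNReal.add_ne_top.2 ⟨hWt, ENNReal.one_ne_top⟩)
  refine ⟨c.toNNReal, fun x₀ r p u hr hpm hum hpI huI hid => ?_⟩
  rw [ENNReal.coe_toNNReal hct]
  haveI hfin : IsFiniteMeasure (volume.restrict (ball x₀ r)) :=
    ⟨by rw [Measure.restrict_apply_univ]; exact measure_ball_lt_top⟩
  -- exponent bookkeeping
  have h32 : (3 / 2 : ℝ≥0∞).toReal = 3 / 2 := by rw [ENNReal.toReal_div]; norm_num
  have h32_0 : (3 / 2 : ℝ≥0∞) ≠ 0 := by norm_num
  have h32_t : (3 / 2 : ℝ≥0∞) ≠ ⊤ := (ENNReal.div_lt_top ENNReal.ofNat_ne_top two_ne_zero).ne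
  have h1le : (1 : ℝ≥0∞) ≤ 3 / 2 := by
    rw [ENNReal.le_div_iff_mul_le (Or.inl two_ne_zero) (Or.inl ENNReal.ofNat_ne_top)]; norm_num
  have h3rpow : ∀ y : ℝ≥0∞, y ^ (3 : ℝ) = y ^ (3 : ℕ) := fun y => by
    rw [show (3 : ℝ) = ((3 : ℕ) : ℝ) by norm_num, ENNReal.rpow_natCast]
  have heLp32 : ∀ (μ : Measure (EuclideanSpace ℝ (Fin 3))) (f : EuclideanSpace ℝ (Fin 3) → ℝ),
      eLpNorm f (3 / 2) μ = (∫⁻ x, ‖f x‖ₑ ^ (3 / 2 : ℝ) ∂μ) ^ (1 / (3 / 2 : ℝ)) := fun μ f => by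
    rw [eLpNorm_eq_lintegral_rpow_enorm_toReal h32_0 h32_t, h32]
  have heLp3 : ∀ (μ : Measure (EuclideanSpace ℝ (Fin 3)))
      (f : EuclideanSpace ℝ (Fin 3) → EuclideanSpace ℝ (Fin 3)),
      eLpNorm f 3 μ = (∫⁻ x, ‖f x‖ₑ ^ (3 : ℕ) ∂μ) ^ (1 / (3 : ℝ)) := fun μ f => by
    rw [eLpNorm_eq_lintegral_rpow_enorm_toReal (by norm_num) (by norm_num), ENNReal.toReal_ofNat]
    simp_rw [h3rpow]
  -- `p ∈ L^{3/2}(B_r) ⊆ L¹(B_r)`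
  have hpmem : MemLp p (3 / 2) (volume.restrict (ball x₀ r)) := by
    refine ⟨hpm, ?_⟩
    rw [heLp32]
    exact ENNReal.rpow_lt_top_of_nonneg (by norm_num) hpI.ne
  have hpint : IntegrableOn p (ball x₀ r) volume := hpmem.integrable h1le
  -- `U = χ_{B_r} u ∈ L³(ℝ³)`
  set U : EuclideanSpace ℝ (Fin 3) → EuclideanSpace ℝ (Fin 3) := (ball x₀ r).indicator u with hU
  have hUm : AEStronglyMeasurable U volume :=
    (aestronglyMeasurable_indicator_iff measurableSet_ball).2 hum
  have hUI : ∫⁻ x, ‖U x‖ₑ ^ (3 : ℕ) = ∫⁻ x in ball x₀ r, ‖u x‖ₑ ^ (3 : ℕ) := by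
    rw [← lintegral_indicator measurableSet_ball]
    refine lintegral_congr fun x => ?_
    rw [hU, enorm_indicator_eq_indicator_enorm]
    by_cases hx : x ∈ ball x₀ r
    · rw [indicator_of_mem hx, indicator_of_mem hx]
    · rw [indicator_of_notMem hx, indicator_of_notMem hx, zero_pow three_ne_zero]
  set Ip := ∫⁻ x in ball x₀ r, ‖p x‖ₑ with hIp
  set Iu := ∫⁻ x in ball x₀ r, ‖u x‖ₑ ^ (3 : ℕ) with hIu
  set Iu1 := ∫⁻ x in ball x₀ (r / 2), ‖u x‖ₑ with hIu1
  have hUmem : MemLp U 3 volume := by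
    refine ⟨hUm, ?_⟩
    rw [heLp3, hUI]
    exact ENNReal.rpow_lt_top_of_nonneg (by norm_num) huI.ne
  -- the whole-space pressure `P = p₁` of `U`
  obtain ⟨P, hPmem, hPle, hPid⟩ := hC U hUmem
  have hIP : ∫⁻ x, ‖P x‖ₑ ^ (3 / 2 : ℝ) ≤ A * Iu := by
    rw [heLp32, heLp3, hUI] at hPle
    have h := ENNReal.rpow_le_rpow hPle (by norm_num : (0 : ℝ) ≤ 3 / 2)
    rw [← ENNReal.rpow_mul, show (1 / (3 / 2 : ℝ)) * (3 / 2) = 1 by norm_num, ENNReal.rpow_one,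
      ENNReal.mul_rpow_of_nonneg _ _ (by norm_num : (0 : ℝ) ≤ 3 / 2), ← ENNReal.rpow_natCast,
      ← ENNReal.rpow_mul, ← ENNReal.rpow_mul,
      show (1 / (3 : ℝ)) * (((2 : ℕ) : ℝ) * (3 / 2)) = 1 by norm_num, ENNReal.rpow_one] at h
    exact h
  have hPint : IntegrableOn P (ball x₀ r) volume := (hPmem.restrict (ball x₀ r)).integrable h1le
  -- ## the `p₁`-pairing: `∫_{B_{r/2}} |P||u| ≤ ∫ |P||U| ≤ ‖P‖_{3/2} ‖U‖₃ ≤ A^{2/3} Iu`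
  have hPU : ∫⁻ x in ball x₀ (r / 2), ‖P x‖ₑ * ‖u x‖ₑ ≤ A' * Iu := by
    have hsub : ball x₀ (r / 2) ⊆ ball x₀ r := ball_subset_ball (by linarith)
    have h1 : ∫⁻ x in ball x₀ (r / 2), ‖P x‖ₑ * ‖u x‖ₑ ≤ ∫⁻ x, ‖P x‖ₑ * ‖U x‖ₑ := by
      calc ∫⁻ x in ball x₀ (r / 2), ‖P x‖ₑ * ‖u x‖ₑ
          ≤ ∫⁻ x in ball x₀ r, ‖P x‖ₑ * ‖u x‖ₑ := lintegral_mono_set hsub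
        _ = ∫⁻ x in ball x₀ r, ‖P x‖ₑ * ‖U x‖ₑ := by
            refine setLIntegral_congr_fun measurableSet_ball (fun x hx => ?_)
            rw [hU, indicator_of_mem hx]
        _ ≤ ∫⁻ x, ‖P x‖ₑ * ‖U x‖ₑ := setLIntegral_le_lintegral _ _
    refine h1.trans ?_
    -- Hölder with exponents `3/2` and `3`
    have hpq : Real.HolderConjugate (3 / 2 : ℝ) 3 := ⟨by norm_num, by norm_num, by norm_num⟩
    have h2 := ENNReal.lintegral_mul_le_Lp_mul_Lq volume hpq hPmem.1.enorm hUm.enorm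
    refine h2.trans ?_
    have h3 : (∫⁻ x, ‖U x‖ₑ ^ (3 : ℝ)) ^ (1 / (3 : ℝ)) = Iu ^ (1 / (3 : ℝ)) := by
      simp_rw [h3rpow]; rw [hUI]
    rw [h3]
    calc (∫⁻ x, ‖P x‖ₑ ^ (3 / 2 : ℝ)) ^ (1 / (3 / 2 : ℝ)) * Iu ^ (1 / (3 : ℝ))
        ≤ (A * Iu) ^ (1 / (3 / 2 : ℝ)) * Iu ^ (1 / (3 : ℝ)) := by
          gcongr
      _ = A' * Iu := by
          rw [show (1 / (3 / 2 : ℝ)) = 2 / 3 by norm_num,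
            ENNReal.mul_rpow_of_nonneg _ _ (by norm_num : (0 : ℝ) ≤ 2 / 3), hA', mul_assoc,
            ← ENNReal.rpow_add_of_nonneg _ _ (by norm_num : (0 : ℝ) ≤ 2 / 3) (by norm_num : (0 : ℝ) ≤ 1 / 3),
            show (2 / 3 : ℝ) + 1 / 3 = 1 by norm_num, ENNReal.rpow_one]
  -- ## the harmonic part `h = p₂ = p - P`
  set h : EuclideanSpace ℝ (Fin 3) → ℝ := fun x => p x - P x with hh
  have hhint : IntegrableOn h (ball x₀ r) volume := hpint.sub hPint
  have hharm : ∀ φ : EuclideanSpace ℝ (Fin 3) → ℝ, ContDiff ℝ (⊤ : ℕ∞) φ → HasCompactSupport φ →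
      tsupport φ ⊆ ball x₀ r → ∫ x, h x * (Δ φ) x = 0 := by
    intro φ hφ hφc hφs
    have hφ2 : ContDiff ℝ 2 φ := contDiff_infty.1 hφ 2
    have hΔc : Continuous (Δ φ) := FluidPDE.continuous_laplacian hφ2
    have hΔ0 : ∀ x ∉ tsupport φ, Δ φ x = 0 := fun x hx =>
      FluidPDE.laplacian_eq_zero_of_notMem_tsupport hx
    have hK : IsCompact (tsupport φ) := hφc
    have hi : ∀ {g : EuclideanSpace ℝ (Fin 3) → ℝ}, IntegrableOn g (ball x₀ r) volume →
        Integrable (fun x => g x * (Δ φ) x) := fun hg => by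
      have h1 := integrable_mul_of_eq_zero_off_compact hK hΔc hΔ0 (hg.mono_set hφs)
      simpa only [mul_comm] using h1
    have e : (fun x => h x * (Δ φ) x) = fun x => p x * (Δ φ) x - P x * (Δ φ) x := by
      funext x; simp only [hh, sub_mul]
    rw [e, integral_sub (hi hpint) (hi hPint), hid φ hφ hφc hφs, hPid φ hφ hφc]
    have e2 : (fun x => fderiv ℝ (fderiv ℝ φ) x (U x) (U x)) =
        fun x => fderiv ℝ (fderiv ℝ φ) x (u x) (u x) := by
      funext x
      by_cases hx : x ∈ ball x₀ r
      · simp only [hU, indicator_of_mem hx]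
      · have hx' : x ∉ tsupport φ := fun h' => hx (hφs h')
        rw [fderiv_fderiv_eq_zero_of_notMem_tsupport hx']
        simp
    rw [e2, sub_self]
  -- the interior bound for `h` on `B_{r/2}`
  have hB := hB3 h x₀ r hr hhint hharm
  set Λ : ℝ≥0∞ := ENNReal.ofReal (C₃ * (r ^ 3)⁻¹ * ∫ y in ball x₀ r, |h y|) with hΛ
  have hae : ∀ᵐ x ∂(volume.restrict (ball x₀ (r / 2))), ‖h x‖ₑ ≤ Λ := by
    filter_upwards [hB] with x hx
    rw [Real.enorm_eq_ofReal_abs]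
    exact ENNReal.ofReal_le_ofReal hx
  have hΛeq : Λ = ENNReal.ofReal C₃ * ENNReal.ofReal ((r ^ 3)⁻¹) * ∫⁻ y in ball x₀ r, ‖h y‖ₑ := by
    rw [hΛ, ENNReal.ofReal_mul (mul_nonneg hC₃0 (inv_nonneg.2 (pow_nonneg hr.le 3))),
      ENNReal.ofReal_mul hC₃0]
    congr 1
    have e : (∫ y in ball x₀ r, |h y|) = ∫ y in ball x₀ r, ‖h y‖ := by
      simp only [Real.norm_eq_abs]
    rw [e, ofReal_integral_norm_eq_lintegral_enorm hhint]
  -- `∫_{B_{r/2}} |h||u| ≤ Λ ∫_{B_{r/2}} |u|`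
  have hhu : ∫⁻ x in ball x₀ (r / 2), ‖h x‖ₑ * ‖u x‖ₑ ≤ Λ * Iu1 := by
    calc ∫⁻ x in ball x₀ (r / 2), ‖h x‖ₑ * ‖u x‖ₑ ≤ ∫⁻ x in ball x₀ (r / 2), Λ * ‖u x‖ₑ :=
          lintegral_mono_ae (hae.mono fun x hx => mul_le_mul' hx le_rfl)
      _ = Λ * Iu1 := by
          rw [hIu1, lintegral_const_mul' _ _ (by rw [hΛ]; exact ENNReal.ofReal_ne_top)]
  -- `∫_{B_r} |h| ≤ ∫_{B_r} |p| + ∫_{B_r} |P|` and `∫_{B_r}|P| ≤ |B_r|^{1/3} ‖P‖_{3/2} ≤ W r A' Iu^{2/3}`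
  have hd : Module.finrank ℝ (EuclideanSpace ℝ (Fin 3)) = 3 := by simp
  have hVr : volume (ball x₀ r) = ENNReal.ofReal (r ^ 3) * V₁ := by
    rw [Measure.addHaar_ball_of_pos volume x₀ hr, hd]
  have hIPone : ∫⁻ x in ball x₀ r, ‖P x‖ₑ ≤ W * ENNReal.ofReal r * (A' * Iu ^ (2 / 3 : ℝ)) := by
    -- Hölder `∫_{B_r} |P| · 1 ≤ (∫_{B_r}|P|^{3/2})^{2/3} |B_r|^{1/3}`
    have hpq : Real.HolderConjugate (3 / 2 : ℝ) 3 := ⟨by norm_num, by norm_num, by norm_num⟩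
    have h1 := ENNReal.lintegral_mul_le_Lp_mul_Lq (volume.restrict (ball x₀ r)) hpq
      (hPmem.restrict (ball x₀ r)).1.enorm (aemeasurable_const (b := (1 : ℝ≥0∞)))
    simp only [Pi.mul_apply, mul_one, ENNReal.one_rpow, lintegral_const, one_mul,
      Measure.restrict_apply_univ] at h1
    refine h1.trans ?_
    have h2 : (∫⁻ x in ball x₀ r, ‖P x‖ₑ ^ (3 / 2 : ℝ)) ^ (1 / (3 / 2 : ℝ)) ≤ A' * Iu ^ (2 / 3 : ℝ) := by
      calc (∫⁻ x in ball x₀ r, ‖P x‖ₑ ^ (3 / 2 : ℝ)) ^ (1 / (3 / 2 : ℝ))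
          ≤ (A * Iu) ^ (1 / (3 / 2 : ℝ)) := by
            gcongr
            exact (setLIntegral_le_lintegral _ _).trans hIP
        _ = A' * Iu ^ (2 / 3 : ℝ) := by
            rw [show (1 / (3 / 2 : ℝ)) = 2 / 3 by norm_num,
              ENNReal.mul_rpow_of_nonneg _ _ (by norm_num : (0 : ℝ) ≤ 2 / 3)]
    have h3 : (volume (ball x₀ r)) ^ (1 / (3 : ℝ)) = W * ENNReal.ofReal r := by
      rw [hVr, ENNReal.mul_rpow_of_nonneg _ _ (by norm_num : (0 : ℝ) ≤ 1 / 3), hW, mul_comm,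
        ENNReal.ofReal_rpow_of_nonneg (pow_nonneg hr.le 3) (by norm_num : (0 : ℝ) ≤ 1 / 3),
        ← Real.rpow_natCast, ← Real.rpow_mul hr.le]
      norm_num
    calc (∫⁻ x in ball x₀ r, ‖P x‖ₑ ^ (3 / 2 : ℝ)) ^ (1 / (3 / 2 : ℝ)) * (volume (ball x₀ r)) ^ (1 / (3 : ℝ))
        ≤ (A' * Iu ^ (2 / 3 : ℝ)) * (W * ENNReal.ofReal r) := by rw [← h3]; gcongr
      _ = W * ENNReal.ofReal r * (A' * Iu ^ (2 / 3 : ℝ)) := by ring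
  have hIh : ∫⁻ y in ball x₀ r, ‖h y‖ₑ ≤ Ip + W * ENNReal.ofReal r * (A' * Iu ^ (2 / 3 : ℝ)) := by
    calc ∫⁻ y in ball x₀ r, ‖h y‖ₑ ≤ ∫⁻ y in ball x₀ r, (‖p y‖ₑ + ‖P y‖ₑ) := by
          refine lintegral_mono fun y => ?_
          calc ‖h y‖ₑ = ‖p y + (-P y)‖ₑ := by simp only [hh, sub_eq_add_neg]
            _ ≤ ‖p y‖ₑ + ‖-P y‖ₑ := enorm_add_le _ _
            _ = ‖p y‖ₑ + ‖P y‖ₑ := by rw [enorm_neg]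
      _ = Ip + ∫⁻ y in ball x₀ r, ‖P y‖ₑ := by rw [hIp, lintegral_add_left' hpm.enorm]
      _ ≤ Ip + W * ENNReal.ofReal r * (A' * Iu ^ (2 / 3 : ℝ)) := add_le_add le_rfl hIPone
  -- ## assembly
  have hsplit : ∫⁻ x in ball x₀ (r / 2), ‖p x‖ₑ * ‖u x‖ₑ ≤
      (∫⁻ x in ball x₀ (r / 2), ‖P x‖ₑ * ‖u x‖ₑ) + ∫⁻ x in ball x₀ (r / 2), ‖h x‖ₑ * ‖u x‖ₑ := by
    have hPm2 : AEStronglyMeasurable P (volume.restrict (ball x₀ (r / 2))) := (hPmem.restrict _).1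
    have hum2 : AEStronglyMeasurable u (volume.restrict (ball x₀ (r / 2))) :=
      hum.mono_measure (Measure.restrict_mono (ball_subset_ball (by linarith)) le_rfl)
    calc ∫⁻ x in ball x₀ (r / 2), ‖p x‖ₑ * ‖u x‖ₑ
        ≤ ∫⁻ x in ball x₀ (r / 2), (‖P x‖ₑ * ‖u x‖ₑ + ‖h x‖ₑ * ‖u x‖ₑ) := by
          refine lintegral_mono fun x => ?_
          rw [← add_mul]
          refine mul_le_mul' ?_ le_rfl
          calc ‖p x‖ₑ = ‖P x + h x‖ₑ := by simp only [hh, add_sub_cancel]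
            _ ≤ ‖P x‖ₑ + ‖h x‖ₑ := enorm_add_le _ _
      _ = (∫⁻ x in ball x₀ (r / 2), ‖P x‖ₑ * ‖u x‖ₑ) + ∫⁻ x in ball x₀ (r / 2), ‖h x‖ₑ * ‖u x‖ₑ :=
          lintegral_add_left' (hPm2.enorm.mul hum2.enorm) _
  have hR3t : ENNReal.ofReal ((r ^ 3)⁻¹) ≠ ⊤ := ENNReal.ofReal_ne_top
  calc ∫⁻ x in ball x₀ (r / 2), ‖p x‖ₑ * ‖u x‖ₑ
      ≤ A' * Iu + Λ * Iu1 := hsplit.trans (add_le_add hPU hhu)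
    _ ≤ A' * Iu + ENNReal.ofReal C₃ * ENNReal.ofReal ((r ^ 3)⁻¹) *
          (Ip + W * ENNReal.ofReal r * (A' * Iu ^ (2 / 3 : ℝ))) * Iu1 := by
        rw [hΛeq]; gcongr
    _ ≤ c * (Iu + ENNReal.ofReal ((r ^ 3)⁻¹) * Iu1 * (Ip + ENNReal.ofReal r * Iu ^ (2 / 3 : ℝ))) := by
        -- expand the constant `c = (A'+1)(C₃+1)(W+1)` and compare term by term
        have hA'le : A' ≤ c := by
          calc A' ≤ (A' + 1) := le_self_add
            _ ≤ (A' + 1) * (ENNReal.ofReal C₃ + 1) := le_mul_of_one_le_right zero_le le_add_self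
            _ ≤ (A' + 1) * (ENNReal.ofReal C₃ + 1) * (W + 1) :=
                le_mul_of_one_le_right zero_le le_add_self
        have hC₃le : ENNReal.ofReal C₃ ≤ c := by
          calc ENNReal.ofReal C₃ ≤ (ENNReal.ofReal C₃ + 1) := le_self_add
            _ ≤ (A' + 1) * (ENNReal.ofReal C₃ + 1) := le_mul_of_one_le_left zero_le le_add_self
            _ ≤ (A' + 1) * (ENNReal.ofReal C₃ + 1) * (W + 1) :=
                le_mul_of_one_le_right zero_le le_add_self
        have hCWA : ENNReal.ofReal C₃ * (W * A') ≤ c := by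
          calc ENNReal.ofReal C₃ * (W * A') = A' * ENNReal.ofReal C₃ * W := by ring
            _ ≤ (A' + 1) * (ENNReal.ofReal C₃ + 1) * (W + 1) := by
                gcongr <;> exact le_self_add
        calc A' * Iu + ENNReal.ofReal C₃ * ENNReal.ofReal ((r ^ 3)⁻¹) *
              (Ip + W * ENNReal.ofReal r * (A' * Iu ^ (2 / 3 : ℝ))) * Iu1
            = A' * Iu + (ENNReal.ofReal C₃ * (ENNReal.ofReal ((r ^ 3)⁻¹) * Iu1 * Ip) +
                ENNReal.ofReal C₃ * (W * A') *
                  (ENNReal.ofReal ((r ^ 3)⁻¹) * Iu1 * (ENNReal.ofReal r * Iu ^ (2 / 3 : ℝ)))) := by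
              ring
          _ ≤ c * Iu + (c * (ENNReal.ofReal ((r ^ 3)⁻¹) * Iu1 * Ip) +
                c * (ENNReal.ofReal ((r ^ 3)⁻¹) * Iu1 * (ENNReal.ofReal r * Iu ^ (2 / 3 : ℝ)))) := by
              gcongr
          _ = c * (Iu + ENNReal.ofReal ((r ^ 3)⁻¹) * Iu1 * (Ip + ENNReal.ofReal r * Iu ^ (2 / 3 : ℝ))) := by
              ring

end Summit.NavierStokesRegularity.NavierStokesRegularity.Theorems.PowerGaugeEulerLiouville

end
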